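import Summits.QuantumAdvantage.QuantumAdvantage.Theorems.LocusDialDeclarableMA

/-! # LocusDialDeclarableM — part 2/2 (mechanical split for landing of `LocusDialDeclarableM`; content verbatim; scopes re-opened with their variables) -/

set_option linter.dupNamespace false
noncomputable section
open scoped Classical

namespace Summit.QuantumAdvantage.QuantumAdvantage.Theorems.LocusDial
open Finset
open Literature.Computability.MetaComplexity Literature.Computability.MetaComplexity.Smolensky
variable {N A ℓ : ℕ}

section GreedyM
open Literature.Computability.QuantumComplexity Literature.Computability.QuantumComplexity.RingHLF
open Summit.QuantumAdvantage.AdviceFreeQNC0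
open Summit.QuantumAdvantage.QuantumAdvantage.Theorems.AnchorDial (dev MAnchorable)
variable (P : Fin N → CubeFn (ZMod 3) N) (r : ℕ)
open Summit.QuantumAdvantage.QuantumAdvantage.Theorems.HolonomyDial (selP selP_mem selP_apply xorP xorP_mem
  xorP_apply_bool tPoly tPoly_mem tPoly_apply)
variable (c : Fin ℓ → Fin N → ZMod 3)

/-- the inputs on which NO approximant of the recursion errs. -/
def GoodX (x : Fin N → Bool) : Prop :=
  (∀ k : Fin N, ¬ RazErr c (preI N k) (devPoly P) x) ∧
  (∀ k' k : Fin N, ¬ RazErr c (Ibtw N r k' k) (devPoly P) x) ∧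
  (∀ k' : Fin N, ¬ RazErr c (Iaft N r k') (devPoly P) x)

/-- LocusDialDeclarableM helper `isDecl_iff_gposN` (decomp-qadv land package; see the module docstring). -/
theorem isDecl_iff_gposN (x : Fin N → Bool) (k : Fin N) : IsDecl P x k ↔ k.val = gposN P r x 0 := by
  show IsDecl P x k ↔ k.val = (if h : (dev P x).Nonempty then ((dev P x).min' h).val else 0)
  unfold IsDecl
  by_cases hD : (dev P x).Nonempty
  · rw [dif_pos hD]
    have hne : dev P x ≠ ∅ := nonempty_iff_ne_empty.1 hD
    constructor
    · rintro ⟨h1, h2⟩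
      rcases h2 with h2 | ⟨h2, -⟩
      · apply le_antisymm
        · exact h1 _ (min'_mem _ hD)
        · exact Fin.le_def.1 (min'_le _ _ h2)
      · exact absurd h2 hne
    · intro h
      have hk : k = (dev P x).min' hD := Fin.ext h
      rw [hk]
      exact ⟨fun i hi => Fin.le_def.1 (min'_le _ i hi), Or.inl (min'_mem _ hD)⟩
  · rw [dif_neg hD]
    have hE : dev P x = ∅ := not_nonempty_iff_eq_empty.1 hD
    rw [hE]
    constructor
    · rintro ⟨-, h⟩
      rcases h with h | ⟨-, h⟩
      · exact absurd h (Finset.notMem_empty _)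
      · exact h
    · intro h
      exact ⟨fun i hi => absurd hi (Finset.notMem_empty _), Or.inr ⟨rfl, h⟩⟩

/-- LocusDialDeclarableM helper `greedyAnc_zero_or_one` (decomp-qadv land package; see the module docstring). -/
theorem greedyAnc_zero_or_one (x : Fin N → Bool) (hx : ∀ k : Fin N, ¬ RazErr c (preI N k) (devPoly P) x)
    (k : Fin N) : greedyAnc P c k x = 0 ∨ greedyAnc P c k x = 1 := by
  have hR := razNor_eq_of_not_err c (preI N k) (devPoly P) x (hx k)
  have hDk := devPoly_apply P k x
  unfold greedyAnc
  split_ifs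
  · simp only [Pi.sub_apply, Pi.mul_apply, Pi.one_apply, hR, hDk]
    split_ifs <;> decide
  · simp only [Pi.mul_apply, hR, hDk]
    split_ifs <;> decide

/-- LocusDialDeclarableM helper `greedyAnc_val` (decomp-qadv land package; see the module docstring). -/
theorem greedyAnc_val (x : Fin N → Bool) (hx : ∀ k : Fin N, ¬ RazErr c (preI N k) (devPoly P) x) (k : Fin N) :
    greedyAnc P c k x = if k.val = gposN P r x 0 then 1 else 0 := by
  have hiff := (greedyAnc_eq_one_iff P c x hx k).trans (isDecl_iff_gposN P r x k)
  split_ifs with h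
  · exact hiff.2 h
  · rcases greedyAnc_zero_or_one P c x hx k with h0 | h1
    · exact h0
    · exact absurd (hiff.1 h1) h

/-- the selection event of the transition polynomial. -/
def StepSel (x : Fin N → Bool) (k' k : Fin N) : Prop :=
  (k'.val + r < k.val ∧ k ∈ dev P x ∧ ∀ i ∈ dev P x, k'.val + r < i.val → k.val ≤ i.val) ∨
  (k = k' ∧ ∀ i ∈ dev P x, ¬ k'.val + r < i.val)

/-- LocusDialDeclarableM helper `stepPoly_apply` (decomp-qadv land package; see the module docstring). -/
theorem stepPoly_apply (x : Fin N → Bool) (hx : GoodX P r c x) (k' k : Fin N) :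
    stepPoly P r c k' k x = if StepSel P r x k' k then 1 else 0 := by
  have hval : ∀ i, (devPoly P i x = 0 ↔ i ∉ dev P x) := fun i => by
    rw [devPoly_apply]; split_ifs with h <;> simp [h]
  have hB : razNor c (Ibtw N r k' k) (devPoly P) x =
      if (∀ i : Fin N, k'.val + r < i.val → i.val < k.val → i ∉ dev P x) then 1 else 0 := by
    rw [razNor_eq_of_not_err _ _ _ _ (hx.2.1 k' k)]
    unfold Ibtw
    simp only [mem_filter, mem_univ, true_and, hval, and_imp]
  have hA : razNor c (Iaft N r k') (devPoly P) x = if (∀ i : Fin N, k'.val + r < i.val → i ∉ dev P x) then 1 else 0 := by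
    rw [razNor_eq_of_not_err _ _ _ _ (hx.2.2 k')]
    unfold Iaft
    simp only [mem_filter, mem_univ, true_and, hval]
  have hDk := devPoly_apply P k x
  unfold stepPoly StepSel
  rw [Pi.add_apply]
  by_cases h1 : k'.val + r < k.val
  · have h2 : ¬ k = k' := fun h => by rw [h] at h1; omega
    rw [if_pos h1, if_neg h2, Pi.mul_apply, Pi.zero_apply, add_zero, hB, hDk]
    have hequiv : (∀ i : Fin N, k'.val + r < i.val → i.val < k.val → i ∉ dev P x) ↔
        (∀ i ∈ dev P x, k'.val + r < i.val → k.val ≤ i.val) := by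
      constructor
      · intro h i hi hlt
        exact not_lt.1 fun hik => h i hlt hik hi
      · intro h i hlt hik hi
        exact absurd (h i hi hlt) (by omega)
    by_cases ha : k ∈ dev P x <;> by_cases hb : (∀ i ∈ dev P x, k'.val + r < i.val → k.val ≤ i.val)
    · rw [if_pos ha, if_pos (hequiv.2 hb), if_pos (Or.inl ⟨h1, ha, hb⟩)]; ring
    · rw [if_pos ha, if_neg (fun h => hb (hequiv.1 h)),
        if_neg (fun h => h.elim (fun h' => hb h'.2.2) (fun h' => h2 h'.1))]
      ring
    · rw [if_neg ha, zero_mul, if_neg (fun h => h.elim (fun h' => ha h'.2.1) (fun h' => h2 h'.1))]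
    · rw [if_neg ha, zero_mul, if_neg (fun h => h.elim (fun h' => ha h'.2.1) (fun h' => h2 h'.1))]
  · rw [if_neg h1, Pi.zero_apply, zero_add]
    by_cases h2 : k = k'
    · rw [if_pos h2, hA]
      have hequiv : (∀ i : Fin N, k'.val + r < i.val → i ∉ dev P x) ↔ (∀ i ∈ dev P x, ¬ k'.val + r < i.val) :=
        ⟨fun h i hi hlt => h i hlt hi, fun h i hlt hi => h i hi hlt⟩
      by_cases hb : (∀ i ∈ dev P x, ¬ k'.val + r < i.val)
      · rw [if_pos (hequiv.2 hb), if_pos (Or.inr ⟨h2, hb⟩)]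
      · rw [if_neg (fun h => hb (hequiv.1 h)), if_neg (fun h => h.elim (fun h' => h1 h'.1) (fun h' => hb h'.2))]
    · rw [if_neg h2, Pi.zero_apply]
      simp [h1, h2]

/-- LocusDialDeclarableM helper `stepSel_iff` (decomp-qadv land package; see the module docstring). -/
theorem stepSel_iff (x : Fin N → Bool) (k' k : Fin N) : StepSel P r x k' k ↔ k.val = nxtPosN P r x k'.val := by
  unfold StepSel nxtPosN
  by_cases hne : (nxtSet P r x k'.val).Nonempty
  · rw [dif_pos hne]
    have hμ := (mem_nxtSet P r).1 (min'_mem _ hne)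
    constructor
    · intro h
      rcases h with ⟨h1, h2, h3⟩ | ⟨-, h2⟩
      · apply le_antisymm
        · exact h3 _ hμ.1 hμ.2
        · exact Fin.le_def.1 (min'_le _ k ((mem_nxtSet P r).2 ⟨h2, h1⟩))
      · exact absurd hμ.2 (h2 _ hμ.1)
    · intro h
      have hk : k = (nxtSet P r x k'.val).min' hne := Fin.ext h
      left
      refine ⟨by rw [hk]; exact hμ.2, by rw [hk]; exact hμ.1, fun i hi hlt => ?_⟩
      rw [hk]
      exact Fin.le_def.1 (min'_le _ i ((mem_nxtSet P r).2 ⟨hi, hlt⟩))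
  · rw [dif_neg hne]
    constructor
    · intro h
      rcases h with ⟨h1, h2, -⟩ | ⟨h1, -⟩
      · exact absurd ⟨k, (mem_nxtSet P r).2 ⟨h2, h1⟩⟩ hne
      · rw [h1]
    · intro h
      right
      exact ⟨Fin.ext h, fun i hi hlt => hne ⟨i, (mem_nxtSet P r).2 ⟨hi, hlt⟩⟩⟩

/-- SEMANTICS: on good inputs the `j`-th family declares exactly the `j`-th greedy start. -/
theorem gAncM_apply (hN : 1 ≤ N) (x : Fin N → Bool) (hx : GoodX P r c x) :
    ∀ j (k : Fin N), gAncM P r c j k x = if k.val = gposN P r x j then 1 else 0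
  | 0, k => greedyAnc_val P r c x hx.1 k
  | j + 1, k => by
    show (∑ k' : Fin N, gAncM P r c j k' * stepPoly P r c k' k) x = _
    rw [Finset.sum_apply, Finset.sum_eq_single ⟨gposN P r x j, gposN_lt P r hN x j⟩]
    · rw [Pi.mul_apply, gAncM_apply hN x hx j, if_pos rfl, one_mul, stepPoly_apply P r c x hx, stepSel_iff,
        gposN_succ_eq]
      split_ifs <;> rfl
    · intro k' _ hk'
      rw [Pi.mul_apply, gAncM_apply hN x hx j k', if_neg (fun h => hk' (Fin.ext h)), zero_mul]
    · intro h; exact absurd (mem_univ _) h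

/-- UNIQ on good inputs. -/
theorem card_gAncM_eq_one (hN : 1 ≤ N) (x : Fin N → Bool) (hx : GoodX P r c x) (j : ℕ) :
    (univ.filter fun k : Fin N => gAncM P r c j k x = 1).card = 1 := by
  rw [card_eq_one]
  refine ⟨⟨gposN P r x j, gposN_lt P r hN x j⟩, ?_⟩
  ext k
  rw [mem_filter, mem_singleton, gAncM_apply P r c hN x hx j k]
  simp only [mem_univ, true_and]
  constructor
  · intro h
    by_contra hne
    rw [if_neg (fun h' => hne (Fin.ext h'))] at h
    exact zero_ne_one h
  · intro h; rw [if_pos (by rw [h])]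

/-! ### §R5c DECLARABILITY for general `m` and `MFreeAnchorLoss3 → U` -/

/-- arithmetic: `2^{3k+6} ≤ 3^{4k+4}`. -/
theorem budget_2_3 : ∀ k : ℕ, 2 ^ (3 * k + 6) ≤ 3 ^ (4 * k + 4)
  | 0 => by norm_num
  | k + 1 => by
    have ih := budget_2_3 k
    calc 2 ^ (3 * (k + 1) + 6) = 2 ^ (3 * k + 6) * 2 ^ 3 := by rw [← pow_add]; congr 1
      _ ≤ 3 ^ (4 * k + 4) * 2 ^ 3 := Nat.mul_le_mul_right _ ih
      _ ≤ 3 ^ (4 * k + 4) * 3 ^ 4 := Nat.mul_le_mul_left _ (by norm_num)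
      _ = 3 ^ (4 * (k + 1) + 4) := by rw [← pow_add]; congr 1

/-- arithmetic: the seed budget `2·(n + n² + n)·L ≤ 3^{4L}` for `L = log₂ n ≥ 1`. -/
theorem seed_budgetM (n : ℕ) (hL : 1 ≤ Nat.log 2 n) : 2 * (n + (n * n + n)) * Nat.log 2 n ≤ 3 ^ (4 * Nat.log 2 n) := by
  have hn : n < 2 ^ (Nat.log 2 n + 1) := Nat.lt_pow_succ_log_self one_lt_two n
  have hL2 : Nat.log 2 n < 2 ^ Nat.log 2 n := Nat.lt_pow_self one_lt_two
  obtain ⟨k, hk⟩ : ∃ k, Nat.log 2 n = k + 1 := ⟨Nat.log 2 n - 1, by omega⟩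
  rw [hk] at hn hL2 ⊢
  have hB : n + 1 ≤ 2 ^ (k + 2) := hn
  have hBB := Nat.mul_le_mul hB hB
  have h1 : n + (n * n + n) ≤ 2 ^ (k + 2) * 2 ^ (k + 2) := by nlinarith [hBB]
  calc 2 * (n + (n * n + n)) * (k + 1) ≤ 2 * (2 ^ (k + 2) * 2 ^ (k + 2)) * 2 ^ (k + 1) :=
        Nat.mul_le_mul (Nat.mul_le_mul_left _ h1) hL2.le
    _ = 2 ^ (3 * k + 6) := by rw [← pow_add, ← pow_succ', ← pow_add]; congr 1; ring
    _ ≤ 3 ^ (4 * k + 4) := budget_2_3 k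
    _ = 3 ^ (4 * (k + 1)) := by ring_nf

/-- arithmetic: the degree budget of the `m`-step recursion, `m·(8L+1)·(2+2L^c) ≤ L^{c+3}` for `L ≥ 36m + 4`. -/
theorem greedyM_degree_budget (L c m j : ℕ) (hj : j + 1 ≤ m) (hL : 36 * m + 4 ≤ L) :
    (j + 1) * ((2 + (L ^ c + L ^ c)) + 4 * L * (2 * (2 + (L ^ c + L ^ c)))) ≤ L ^ (c + 3) := by
  set X := L ^ c with hX
  have hX1 : 1 ≤ X := Nat.one_le_pow _ _ (by omega)
  have hL1 : 1 ≤ L := by omega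
  have e : L ^ (c + 3) = L * L * L * X := by rw [hX]; ring
  rw [e]
  have h2 : 2 + (X + X) ≤ 4 * X := by omega
  have hLL : (36 * m + 4) * L ≤ L * L := Nat.mul_le_mul_right _ hL
  have hLLL : L * L ≤ L * L * L := Nat.le_mul_of_pos_right _ (by omega)
  calc (j + 1) * ((2 + (X + X)) + 4 * L * (2 * (2 + (X + X))))
      ≤ m * ((2 + (X + X)) + 4 * L * (2 * (2 + (X + X)))) := Nat.mul_le_mul_right _ hj
    _ = m * (8 * L + 1) * (2 + (X + X)) := by ring
    _ ≤ m * (8 * L + 1) * (4 * X) := Nat.mul_le_mul_left _ h2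
    _ = (32 * m * L + 4 * m) * X := by ring
    _ ≤ ((36 * m + 4) * L) * X := Nat.mul_le_mul_right _ (by nlinarith)
    _ ≤ (L * L * L) * X := Nat.mul_le_mul_right _ (le_trans hLL hLLL)

/-- **DECLARABILITY (all `m`)**: every degree-`(log₂ n)^c` strategy that is few-locus at `(m, r)` is `m`-FREE-anchorable at
width `r` in degree `(log₂ n)^{c+3}` (for `n ≥ 2^{36m+4}`): its `m` windows — wherever they are, however unstably they move —
are declared, a.e. uniquely, by the GREEDY anchor families (leftmost uncovered deviation, recursively) read through Razborov
NOR approximants with one input-averaged seed.  No stability is claimed. -/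
theorem mFreeAnchorable_of_fewLocus (m r c : ℕ) : ∃ n₀ : ℕ, ∀ n ≥ n₀, ∀ P : Fin n → CubeFn (ZMod 3) n,
    (∀ i, P i ∈ lowDeg (ZMod 3) n ((Nat.log 2 n) ^ c)) → FewLocus m r P → MFreeAnchorable m r (c + 3) P := by
  rcases Nat.eq_zero_or_pos m with rfl | hm
  · -- no windows: NEAR fails exactly where the deviation set is nonempty = not `(0, r)`-coverable
    refine ⟨1, fun n hn P hP hF => ⟨fun j => Fin.elim0 j, fun j => Fin.elim0 j, fun j => Fin.elim0 j, ?_⟩⟩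
    have hsub : (univ.filter fun x : Fin n → Bool => OddZeros x ∧
        ¬ ∃ kv : Fin 0 → Fin n, (∀ j, (fun j : Fin 0 => (Fin.elim0 j : Fin n → CubeFn (ZMod 3) n)) j (kv j) x = 1) ∧
          ∀ i ∈ dev P x, ∃ j, (kv j).val ≤ i.val ∧ i.val ≤ (kv j).val + r) ⊆
        univ.filter fun x : Fin n → Bool => OddZeros x ∧ ¬ Coverable 0 r (dev P x) := by
      intro x hx
      rw [mem_filter] at hx ⊢
      refine ⟨mem_univ _, hx.2.1, fun hcov => hx.2.2 ?_⟩
      obtain ⟨kv, hkv⟩ := hcov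
      refine ⟨fun j => Fin.elim0 j, fun j => Fin.elim0 j, fun i hi => ?_⟩
      obtain ⟨j, _⟩ := hkv i hi
      exact Fin.elim0 j
    calc Nat.log 2 n * _ ≤ Nat.log 2 n * (univ.filter fun x : Fin n → Bool => OddZeros x ∧ ¬ Coverable 0 r (dev P x)).card :=
          Nat.mul_le_mul_left _ (card_le_card hsub)
      _ ≤ 2 ^ (n - 1) := hF
      _ ≤ 2 ^ n := Nat.pow_le_pow_right (by norm_num) (Nat.sub_le n 1)
  · refine ⟨2 ^ (36 * m + 4), fun n hn P hP hF => ?_⟩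
    set L := Nat.log 2 n with hLdef
    have hL : 36 * m + 4 ≤ L := by rw [hLdef]; exact Nat.le_log_of_pow_le (by norm_num) hn
    have hn1 : 1 ≤ n := le_trans (Nat.one_le_two_pow) hn
    -- the seed, shared by all sub-families of the recursion
    obtain ⟨c₀, hc₀⟩ := exists_good_razSeed' (ℓ := 4 * L) (ι := Fin n ⊕ ((Fin n × Fin n) ⊕ Fin n))
      (Sum.elim (fun k => preI n k) (Sum.elim (fun p => Ibtw n r p.1 p.2) (fun k' => Iaft n r k'))) (devPoly P)
    have hι : Fintype.card (Fin n ⊕ ((Fin n × Fin n) ⊕ Fin n)) = n + (n * n + n) := by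
      simp [Fintype.card_sum, Fintype.card_prod]
    rw [hι] at hc₀
    set E := (univ.filter fun x : Fin n → Bool => ∃ a : Fin n ⊕ ((Fin n × Fin n) ⊕ Fin n),
      RazErr c₀ (Sum.elim (fun k => preI n k) (Sum.elim (fun p => Ibtw n r p.1 p.2) (fun k' => Iaft n r k')) a)
        (devPoly P) x) with hE
    have hgood : ∀ x, x ∉ E → GoodX P r c₀ x := by
      intro x hx
      rw [hE, mem_filter, not_and] at hx
      have hx' := hx (mem_univ _)
      push Not at hx'
      exact ⟨fun k => hx' (Sum.inl k), fun k' k => hx' (Sum.inr (Sum.inl (k', k))), fun k' => hx' (Sum.inr (Sum.inr k'))⟩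
    have h9 : 2 * (n + (n * n + n)) * L ≤ 3 ^ (4 * L) := seed_budgetM n (by omega)
    have hLE : L * E.card ≤ 2 ^ (n - 1) := by
      have hpow : 2 ^ n = 2 ^ (n - 1) * 2 := by rw [← pow_succ]; congr 1; omega
      have hM : 0 < n + (n * n + n) := by positivity
      have key : L * E.card * (2 * (n + (n * n + n))) ≤ 2 ^ (n - 1) * (2 * (n + (n * n + n))) := by
        calc L * E.card * (2 * (n + (n * n + n))) = E.card * (2 * (n + (n * n + n)) * L) := by ring
          _ ≤ E.card * 3 ^ (4 * L) := Nat.mul_le_mul_left _ h9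
          _ ≤ (n + (n * n + n)) * 2 ^ n := hc₀
          _ = 2 ^ (n - 1) * (2 * (n + (n * n + n))) := by rw [hpow]; ring
      exact Nat.le_of_mul_le_mul_right key (by positivity)
    refine ⟨fun j k => gAncM P r c₀ j.val k, fun j k => ?_, fun j => ?_, ?_⟩
    · -- degree
      exact lowDeg_mono (greedyM_degree_budget L c m j.val j.isLt hL) (gAncM_mem P r c₀ hP j.val k)
    · -- UNIQ a.e.
      have hsub : (univ.filter fun x : Fin n → Bool =>
          OddZeros x ∧ (univ.filter fun k : Fin n => gAncM P r c₀ j.val k x = 1).card ≠ 1) ⊆ E := by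
        intro x hx
        rw [mem_filter] at hx
        by_contra hxE
        exact hx.2.2 (card_gAncM_eq_one P r c₀ hn1 x (hgood x hxE) j.val)
      rw [← hLdef]
      exact le_trans (Nat.mul_le_mul_left _ (card_le_card hsub)) hLE
    · -- NEAR a.e.
      have hsub : (univ.filter fun x : Fin n → Bool => OddZeros x ∧
          ¬ ∃ kv : Fin m → Fin n, (∀ j, (fun (j : Fin m) k => gAncM P r c₀ j.val k) j (kv j) x = 1) ∧
            ∀ i ∈ dev P x, ∃ j, (kv j).val ≤ i.val ∧ i.val ≤ (kv j).val + r) ⊆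
          E ∪ (univ.filter fun x : Fin n → Bool => OddZeros x ∧ ¬ Coverable m r (dev P x)) := by
        intro x hx
        rw [mem_filter] at hx
        rw [mem_union]
        by_contra hno
        push Not at hno
        obtain ⟨hxE, hxC⟩ := hno
        have hg := hgood x hxE
        have hcov : Coverable m r (dev P x) := by
          by_contra h
          exact hxC (mem_filter.2 ⟨mem_univ _, hx.2.1, h⟩)
        apply hx.2.2
        refine ⟨fun j => ⟨gposN P r x j.val, gposN_lt P r hn1 x j.val⟩, fun j => ?_, fun i hi => ?_⟩
        · show gAncM P r c₀ j.val ⟨gposN P r x j.val, _⟩ x = 1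
          rw [gAncM_apply P r c₀ hn1 x hg j.val, if_pos rfl]
        · obtain ⟨s, hs, h1, h2⟩ := greedy_near P r hm x hcov i hi
          exact ⟨⟨s, hs⟩, h1, h2⟩
      have hNC : L * (univ.filter fun x : Fin n → Bool => OddZeros x ∧ ¬ Coverable m r (dev P x)).card ≤ 2 ^ (n - 1) :=
        hF
      have hpow : 2 ^ n = 2 ^ (n - 1) + 2 ^ (n - 1) := by rw [← two_mul, ← pow_succ']; congr 1; omega
      rw [← hLdef, hpow]
      calc L * (univ.filter fun x : Fin n → Bool => OddZeros x ∧
            ¬ ∃ kv : Fin m → Fin n, (∀ j, (fun (j : Fin m) k => gAncM P r c₀ j.val k) j (kv j) x = 1) ∧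
              ∀ i ∈ dev P x, ∃ j, (kv j).val ≤ i.val ∧ i.val ≤ (kv j).val + r).card
          ≤ L * (E ∪ (univ.filter fun x : Fin n → Bool => OddZeros x ∧ ¬ Coverable m r (dev P x))).card :=
            Nat.mul_le_mul_left _ (card_le_card hsub)
        _ ≤ L * (E.card + (univ.filter fun x : Fin n → Bool => OddZeros x ∧ ¬ Coverable m r (dev P x)).card) :=
            Nat.mul_le_mul_left _ (card_union_le _ _)
        _ ≤ 2 ^ (n - 1) + 2 ^ (n - 1) := by rw [mul_add]; exact Nat.add_le_add hLE hNC

/-- **`MFreeAnchorLoss3 → U`**: the unstable-anchor law («a.e.-declared, possibly unstable windows lose») GIVES piece `U`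
(`FewLocusLoss3`) outright — declaration is free, so the whole open content of `U` is the missing STABILITY. -/
theorem fewLocusLoss3_of_mFreeAnchorLoss3 (h : MFreeAnchorLoss3) : FewLocusLoss3 := by
  obtain ⟨C, hC⟩ := h
  refine ⟨C, fun m r c => ?_⟩
  obtain ⟨n₁, hn₁⟩ := hC m r (c + 3)
  obtain ⟨n₂, hn₂⟩ := mFreeAnchorable_of_fewLocus m r c
  refine ⟨max (max n₁ n₂) 4, fun n hn P hP hF => ?_⟩
  have hn1 : n₁ ≤ n := le_trans (le_trans (le_max_left _ _) (le_max_left _ _)) hn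
  have hn2 : n₂ ≤ n := le_trans (le_trans (le_max_right _ _) (le_max_left _ _)) hn
  have hn4 : 4 ≤ n := le_trans (le_max_right _ _) hn
  have hlog : 1 ≤ Nat.log 2 n := Nat.le_log_of_pow_le (by norm_num) (by omega)
  have hdeg : ∀ i, P i ∈ lowDeg (ZMod 3) n ((Nat.log 2 n) ^ (c + 3)) := fun i =>
    lowDeg_mono (Nat.pow_le_pow_right hlog (by omega)) (hP i)
  exact hn₁ n hn1 P hdeg (hn₂ n hn2 P hP hF)

/-- hence `T → MFreeAnchorLoss3 → U` by name (`mFreeAnchorLoss3_of_polyLossOddU3`, this). -/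
theorem fewLocusLoss3_of_polyLossOddU3' (h : Summit.QuantumAdvantage.QuantumAdvantage.Theses.ExactnessDial.PolyLossOddU3) :
    FewLocusLoss3 :=
  fewLocusLoss3_of_mFreeAnchorLoss3 (mFreeAnchorLoss3_of_polyLossOddU3 h)

end GreedyM


end Summit.QuantumAdvantage.QuantumAdvantage.Theorems.LocusDial
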